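import Literature.AlgebraicGeometry.Resolution.InseparableLocalUniformizationLemmas
import Literature.AlgebraicGeometry.Resolution.RatGroupAlgebraTower
import Literature.AlgebraicGeometry.Resolution.RatGroupAlgebraSmooth
import Mathlib.Algebra.Field.ULift
import Mathlib.FieldTheory.RatFunc.AsPolynomial
import Mathlib.RingTheory.DedekindDomain.AdicValuation
import Mathlib.RingTheory.DiscreteValuationRing.TFAE
import Mathlib.RingTheory.Flat.TorsionFree
import HarnessLib

/-!
# `Temkin2013_Lemma332` is refutable: a counterexample to the tree's rendering of Temkin 2013, Lemma 3.3.2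

Topic: `Literature/AlgebraicGeometry/Resolution`. M. Temkin, *Inseparable local uniformization*,
J. Algebra 373 (2013) 65–119 = arXiv:0804.1554, Lemma 3.3.2 (v3 pp. 45–46; p. 28 of the 41-page
arXiv version held in the literature store): "`X = Spec(A)` is an affine integral `S`-scheme OF
NORMALIZED FINITE PRESENTATION and `x ∈ X_η` is a closed point of the generic fiber. Assume that
the FINITE `k`-field `m = k(x)` is provided with a valuation … Lemma 3.3.2. … assume that `x` is
a simple `k`-smooth point. Then there exists an affine `S`-scheme `X′` of normalized finite
presentation and a morphism `f : X′ → X` such that `f_η` is an isomorphism, the closed immersion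
`i_x : Spec(m) → X′_η` extends to a lifting `i′ : S_m → X′` of `i`, and the image of the closed
point of `S_m` under `i′` is smooth-equivalent to the closed point of `S_m`."

The tree's rendering `Temkin2013_Lemma332` (`InseparableLocalUniformizationLemmas.lean`) OMITS
the finiteness hypothesis "normalized finite presentation" (equivalently, given its other data,
"`K/k` finitely generated"): its `IsAffineNormalizedModel ⊤ k° A` only says
`A = Nr_K(k°[f₁, …, f_n])`, `Frac A = K`, with `K` possibly an INFINITE algebraic extension of
`Frac k°[f]`. The corrected rendering `Temkin2013_Lemma332_nft`
(`InseparableLocalUniformizationDecompletion.lean`) restores it. This file PROVES that the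
uncorrected rendering is false:

* `not_temkin2013_Lemma332 : ¬ Temkin2013_Lemma332` — PROVED, in every universe.

## The counterexample (`Lemma332Counterexample`)

Data (for any field `F` of characteristic zero; `F = ULift ℚ` at the end):
* `k = F(X)` with the `X`-adic valuation ring `k° = F[X]_{(X)}` (`Ok`; a DVR: height one,
  equicharacteristic — `ringKrullDim_Ok`, `ringChar_residueField_Ok`);
* `K = Frac k[ℚ]` (`KField`), the fraction field of the group algebra `G = k[ℚ]` (`GAlg`) of the
  rationals, i.e. `K = k(t^q : q ∈ ℚ)`: an infinite algebraic extension of `k(t)`;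
* `A = Nr_K(k°[t, t⁻¹])` (`Amodel`; generators `sgen = {t, t⁻¹}`): an affine normalized model in
  the sense of `IsAffineNormalizedModel ⊤` (`isAffineNormalizedModel_Amodel`: every `t^q` is
  integral over `k°[t^{±1}]`, `tq_mem_Amodel`, and `Frac A = K` by clearing denominators,
  `exists_div_eq`);
* the generic fibre `k[A] = adjoin k A` is the image of `k[ℚ]` (`adjoin_Amodel_eq_GK`, using that
  `k[ℚ]` is integrally closed, `RatGroupAlgebra.isIntegrallyClosed_rat`), `eS : k[ℚ] ≃ k[A]`;
* `m = k`, `φ : k[A] → k` the augmentation `t^q ↦ 1` (`phi`), a surjective `k`-algebra map; the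
  point `x = ker φ` is `k`-rational (`m = k`, trivially separable over `k`) and `k`-SMOOTH:
  `k[A] ≅ k[ℚ]` is formally smooth over `k` (`RatGroupAlgebra.formallySmooth_rat`), hence so is
  its local ring at `x`;
* `m° = k°`, and `φ(A) ⊆ k°` (`phi_mem_Ok_of_mem_Amodel`: `φ` maps `k°[t^{±1}]` into `k°` and `k°`
  is integrally closed).

Refutation of the conclusion (`no_smooth_cover`): let `A ≤ A′ ≤ k[A]` be any refinement
containing `k°`, and suppose `D` is a ring, smooth over `A′` and over `k°` compatibly, with a
prime ideal (so `D ≠ 0`) — as `AreSmoothEquivalent` would provide. Let `π ∈ k°` be a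
uniformizer and `E = D[1/π]`. Then (i) `E ≠ 0`, since `π` is `D`-regular by flatness of `D` over
`k°`; (ii) `E` is a `k`-algebra of finite type: every nonzero `c = uπⁿ ∈ k°` becomes a unit in
`E`, so `k = Frac k° → E`, and `E` is finitely presented over `k°`; (iii) `E` is a finitely
presented `k[ℚ]`-algebra: `k[A] = A′[1/π]` (clearing denominators again) and `E` is finitely
presented over `A′`, hence over `k[A] ≅ k[ℚ]`; the two `k`-structures agree because the structure
maps of `D` agree on `k°`. This contradicts the tower obstruction
`RatGroupAlgebra.subsingleton_of_finitePresentation_of_finiteType` (a finitely presented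
`k[ℚ]`-algebra of finite type over `k` is zero). Hence no `A′` as in the conclusion of
`Temkin2013_Lemma332` exists.

(The docstring of `InseparableLocalUniformizationDecompletion.lean` sketches a different,
arithmetic counterexample with `K = m = kˢᵉᵖ`; the one formalized here only needs characteristic
zero and the structure of `k[ℚ]` as a directed union of Laurent polynomial rings.)

## Sources

* M. Temkin, *Inseparable local uniformization*, J. Algebra 373 (2013) 65–119 =
  arXiv:0804.1554v3, Lemma 3.3.2 (pp. 45–46; held version p. 28), §2.2 (normalized finite
  type/presentation), Definition 2.8.1 (smooth-equivalence).
-/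

noncomputable section

open AddMonoidAlgebra IsDedekindDomain

namespace Literature.AlgebraicGeometry.Resolution

universe u

namespace Lemma332Counterexample

open RatGroupAlgebra

variable (F : Type u) [Field F]

/-! ### The base: `k = F(X)` with the `X`-adic valuation -/

/-- The `X`-adic valuation ring `k° = F[X]_{(X)} ⊆ k = F(X)` (Mathlib's
`valuationSubringAtPrime` at the height-one prime `(X)`). [folklore] -/
abbrev Ok : ValuationSubring (RatFunc F) :=
  HeightOneSpectrum.valuationSubringAtPrime (RatFunc F) (Polynomial.idealX F)

/-- `k°` is a discrete valuation ring (localization of the Dedekind domain `F[X]` at a nonzero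
prime). [folklore] -/
theorem isDiscreteValuationRing_Ok : IsDiscreteValuationRing (Ok F) :=
  IsLocalization.AtPrime.isDiscreteValuationRing_of_dedekind_domain (Polynomial F)
    (Polynomial.idealX F).ne_bot _

/-- `k°` has height one. [folklore] -/
theorem ringKrullDim_Ok : ringKrullDim (Ok F) = 1 :=
  haveI := isDiscreteValuationRing_Ok F
  IsDiscreteValuationRing.ringKrullDim_eq_one _

/-- The constants lie in `k°`. [folklore] -/
theorem algebraMap_mem_Ok (c : F) : algebraMap F (RatFunc F) c ∈ Ok F := by
  rw [Ok, HeightOneSpectrum.valuationSubringAtPrime_eq_valuationSubring,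
    Valuation.mem_valuationSubring_iff, IsScalarTower.algebraMap_apply F (Polynomial F) (RatFunc F)]
  exact HeightOneSpectrum.valuation_le_one _ _

/-- `k` is equicharacteristic (its valuation ring contains the field `F`). [folklore] -/
theorem ringChar_residueField_Ok :
    ringChar (IsLocalRing.ResidueField (Ok F)) = ringChar (RatFunc F) :=
  ringChar_residueField_eq_of_algebraMap_mem (Ok F) (algebraMap_mem_Ok F)

/-! ### The group algebra `G = k[ℚ]`, its fraction field `K`, and the model `A` -/

/-- `G = k[ℚ]`. [folklore] -/
abbrev GAlg : Type u := AddMonoidAlgebra (RatFunc F) ℚ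

/-- `K = Frac k[ℚ] = k(t^q : q ∈ ℚ)`. [folklore] -/
abbrev KField : Type u := FractionRing (GAlg F)

/-- `t^q ∈ K`. [folklore] -/
def tq (q : ℚ) : KField F := algebraMap (GAlg F) (KField F) (single q 1)

/-- `t^{q+r} = t^q t^r`. [folklore] -/
theorem tq_add (q r : ℚ) : tq F (q + r) = tq F q * tq F r := by
  rw [tq, tq, tq, ← map_mul, single_mul_single, mul_one]

/-- `t⁰ = 1`. [folklore] -/
theorem tq_zero : tq F 0 = 1 := by
  rw [tq, ← one_def, map_one]

/-- `t^{nq} = (t^q)ⁿ`. [folklore] -/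
theorem tq_nsmul (n : ℕ) (q : ℚ) : tq F (n • q) = tq F q ^ n := by
  rw [tq, tq, ← map_pow, single_pow, one_pow]

/-- The image `R₀` of `k°` in `K`. [folklore] -/
abbrev R0 : Subring (KField F) := (Ok F).toSubring.map (algebraMap (RatFunc F) (KField F))

open Classical in
/-- The generators `{t, t⁻¹}` of the first affine model. [folklore] -/
def sgen : Finset (KField F) := {tq F 1, tq F (-1)}

/-- `t ∈ sgen`. [folklore] -/
theorem tq_one_mem_sgen : tq F 1 ∈ sgen F := by
  classical exact Finset.mem_insert_self _ _

/-- `t⁻¹ ∈ sgen`. [folklore] -/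
theorem tq_neg_one_mem_sgen : tq F (-1) ∈ sgen F := by
  classical exact Finset.mem_insert_of_mem (Finset.mem_singleton_self _)

/-- `C₀ = k°[t, t⁻¹] ⊆ K`. [folklore] -/
abbrev C0 : Subring (KField F) :=
  Subring.closure ((R0 F : Set (KField F)) ∪ ↑(sgen F))

/-- `A = Nr_K(k°[t, t⁻¹])`, the affine normalized model of the counterexample. [folklore] -/
abbrev Amodel : Subring (KField F) := nrIn (C0 F)

/-- `t^z ∈ C₀` for `z ∈ ℤ`. [folklore] -/
theorem tq_int_mem_C0 (z : ℤ) : tq F z ∈ C0 F := by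
  induction z using Int.induction_on with
  | zero => simp only [Int.cast_zero, tq_zero]; exact Subring.one_mem _
  | succ n ih =>
    rw [Int.cast_add, Int.cast_natCast, Int.cast_one, tq_add]
    rw [Int.cast_natCast] at ih
    exact Subring.mul_mem _ ih (Subring.subset_closure (Or.inr (tq_one_mem_sgen F)))
  | pred n ih =>
    rw [Int.cast_sub, Int.cast_neg, Int.cast_natCast, Int.cast_one, sub_eq_add_neg, tq_add]
    rw [Int.cast_neg, Int.cast_natCast] at ih
    exact Subring.mul_mem _ ih (Subring.subset_closure (Or.inr (tq_neg_one_mem_sgen F)))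

/-- `t^q ∈ A`: it is integral over `C₀`, `(t^q)^{den q} = t^{num q} ∈ C₀`. [folklore] -/
theorem tq_mem_Amodel (q : ℚ) : tq F q ∈ Amodel F := by
  rw [Amodel, mem_nrIn_iff]
  refine ⟨Polynomial.X ^ q.den - Polynomial.C ⟨tq F q.num, tq_int_mem_C0 F q.num⟩,
    Polynomial.monic_X_pow_sub_C _ q.den_nz, ?_⟩
  simp only [Polynomial.eval₂_sub, Polynomial.eval₂_X_pow, Polynomial.eval₂_C]
  rw [← tq_nsmul, nsmul_eq_mul, Rat.den_mul_eq_num, sub_eq_zero]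
  rfl

/-- `R₀ ∋` the image of any `c ∈ k°`. [folklore] -/
theorem algebraMap_mem_R0 (c : Ok F) : algebraMap (RatFunc F) (KField F) c ∈ R0 F :=
  ⟨c, c.2, rfl⟩

/-- `R₀ ⊆ A`. [folklore] -/
theorem R0_le_Amodel : R0 F ≤ Amodel F := fun _ hx =>
  le_nrIn _ (Subring.subset_closure (Or.inl hx))

/-- `c t^q ↦ c · t^q` in `K`. [folklore] -/
theorem algebraMap_single (q : ℚ) (a : RatFunc F) :
    algebraMap (GAlg F) (KField F) (single q a) = algebraMap (RatFunc F) (KField F) a * tq F q := by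
  rw [tq, ← mul_one a, ← smul_eq_mul, ← smul_single, smul_eq_mul, mul_one, Algebra.smul_def, map_mul,
    ← IsScalarTower.algebraMap_apply]

/-- **Clearing denominators**: every `f ∈ k[ℚ]` becomes an element of `A` after multiplication by
a nonzero constant of `k°`. [folklore] -/
theorem exists_smul_mem_Amodel (f : GAlg F) :
    ∃ c : Ok F, c ≠ 0 ∧
      algebraMap (RatFunc F) (KField F) c * algebraMap (GAlg F) (KField F) f ∈ Amodel F := by
  induction f using AddMonoidAlgebra.induction_linear with
  | zero => exact ⟨1, one_ne_zero, by rw [map_zero, mul_zero]; exact Subring.zero_mem _⟩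
  | add f g hf hg =>
    obtain ⟨c, hc, hcf⟩ := hf
    obtain ⟨d, hd, hdg⟩ := hg
    refine ⟨c * d, mul_ne_zero hc hd, ?_⟩
    have : algebraMap (RatFunc F) (KField F) ↑(c * d) * algebraMap (GAlg F) (KField F) (f + g) =
        algebraMap (RatFunc F) (KField F) d *
          (algebraMap (RatFunc F) (KField F) c * algebraMap (GAlg F) (KField F) f) +
        algebraMap (RatFunc F) (KField F) c *
          (algebraMap (RatFunc F) (KField F) d * algebraMap (GAlg F) (KField F) g) := by
      simp only [MulMemClass.coe_mul, map_mul, map_add]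
      ring
    rw [this]
    exact Subring.add_mem _ (Subring.mul_mem _ (R0_le_Amodel F (algebraMap_mem_R0 F d)) hcf)
      (Subring.mul_mem _ (R0_le_Amodel F (algebraMap_mem_R0 F c)) hdg)
  | single q a =>
    obtain ⟨n, d, hd, hnd⟩ := IsFractionRing.div_surjective (A := Ok F) a
    have hd0 : (d : RatFunc F) ≠ 0 := by
      intro h
      apply nonZeroDivisors.ne_zero hd
      exact_mod_cast h
    refine ⟨d, nonZeroDivisors.ne_zero hd, ?_⟩
    rw [algebraMap_single, ← mul_assoc, ← map_mul, ← hnd]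
    change algebraMap (RatFunc F) (KField F) ((d : RatFunc F) * ((n : RatFunc F) / d)) * tq F q ∈ _
    rw [mul_div_cancel₀ _ hd0]
    exact Subring.mul_mem _ (R0_le_Amodel F (algebraMap_mem_R0 F n)) (tq_mem_Amodel F q)

/-- **`Frac A = K`.** [folklore] -/
theorem exists_div_eq (z : KField F) : ∃ a ∈ Amodel F, ∃ b ∈ Amodel F, z = a / b := by
  obtain ⟨f, g, -, rfl⟩ := IsFractionRing.div_surjective (A := GAlg F) z
  obtain ⟨c, hc, hcf⟩ := exists_smul_mem_Amodel F f
  obtain ⟨d, hd, hdg⟩ := exists_smul_mem_Amodel F g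
  have hc0 : algebraMap (RatFunc F) (KField F) c ≠ 0 := by
    rw [Ne, map_eq_zero_iff _ (algebraMap (RatFunc F) (KField F)).injective]
    exact_mod_cast hc
  have hd0 : algebraMap (RatFunc F) (KField F) d ≠ 0 := by
    rw [Ne, map_eq_zero_iff _ (algebraMap (RatFunc F) (KField F)).injective]
    exact_mod_cast hd
  refine ⟨algebraMap (RatFunc F) (KField F) d *
      (algebraMap (RatFunc F) (KField F) c * algebraMap (GAlg F) (KField F) f),
    Subring.mul_mem _ (R0_le_Amodel F (algebraMap_mem_R0 F d)) hcf,
    algebraMap (RatFunc F) (KField F) c *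
      (algebraMap (RatFunc F) (KField F) d * algebraMap (GAlg F) (KField F) g),
    Subring.mul_mem _ (R0_le_Amodel F (algebraMap_mem_R0 F c)) hdg, ?_⟩
  rw [show algebraMap _ _ (d : RatFunc F) * (algebraMap _ _ (c : RatFunc F) * algebraMap _ _ f) =
      algebraMap _ _ (c : RatFunc F) * (algebraMap (RatFunc F) (KField F) (d : RatFunc F) *
        algebraMap (GAlg F) (KField F) f) by ring,
    mul_div_mul_left _ _ hc0, mul_div_mul_left _ _ hd0]

/-- **`A` is an affine normalized model** of `K` over `k°` in the sense of
`IsAffineNormalizedModel ⊤` (generators `{t, t⁻¹}`). [folklore] -/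
theorem isAffineNormalizedModel_Amodel : IsAffineNormalizedModel ⊤ (R0 F) (Amodel F) :=
  ⟨sgen F, fun _ _ => trivial, Set.ext fun _ => Iff.rfl, exists_div_eq F⟩

/-! ### The generic fibre `k[A]` is the image of `k[ℚ]` -/

/-- The image of `G = k[ℚ]` in `K`, as a `k`-subalgebra. [folklore] -/
abbrev GK : Subalgebra (RatFunc F) (KField F) :=
  (IsScalarTower.toAlgHom (RatFunc F) (GAlg F) (KField F)).range

/-- `G ≅` its image in `K`. [folklore] -/
def eGK : GAlg F ≃ₐ[RatFunc F] GK F :=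
  AlgEquiv.ofInjective _ (IsFractionRing.injective (GAlg F) (KField F))

/-- `eGK` followed by the inclusion is the structure map `G → K`. [folklore] -/
theorem algebraMap_eGK_symm (y : GK F) : algebraMap (GAlg F) (KField F) ((eGK F).symm y) = y := by
  conv_rhs => rw [← (eGK F).apply_symm_apply y]
  rfl

/-- `C₀ ⊆` the image of `k[ℚ]`. [folklore] -/
theorem C0_le_GK : C0 F ≤ (GK F).toSubring := by
  rw [Subring.closure_le]
  rintro x (⟨c, -, rfl⟩ | hx)
  · exact ⟨algebraMap (RatFunc F) (GAlg F) c, (IsScalarTower.algebraMap_apply _ _ _ c).symm⟩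
  · have : x = tq F 1 ∨ x = tq F (-1) := by
      classical simpa [sgen] using hx
    rcases this with rfl | rfl <;> exact ⟨single _ 1, rfl⟩

/-- Elements of `K` integral over `C₀` come from `k[ℚ]` (`k[ℚ]` is integrally closed).
[folklore] -/
theorem exists_algebraMap_eq_of_isIntegral {x : KField F} (hx : IsIntegral (C0 F) x) :
    ∃ f : GAlg F, algebraMap (GAlg F) (KField F) f = x := by
  let ρ : C0 F →+* GAlg F :=
    (eGK F).symm.toAlgHom.toRingHom.comp ((C0 F).subtype.codRestrict (GK F) fun c => C0_le_GK F c.2)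
  have hρ : (algebraMap (GAlg F) (KField F)).comp ρ = algebraMap (C0 F) (KField F) :=
    RingHom.ext fun c => algebraMap_eGK_symm F ⟨(c : KField F), C0_le_GK F c.2⟩
  have hx' : IsIntegral (GAlg F) x := by
    obtain ⟨p, hp, hpx⟩ := hx
    refine ⟨p.map ρ, hp.map ρ, ?_⟩
    rwa [Polynomial.eval₂_map, hρ]
  haveI := isIntegrallyClosed_rat (RatFunc F)
  exact (IsIntegrallyClosed.isIntegral_iff (R := GAlg F) (K := KField F)).mp hx'

/-- **The generic fibre `k[A] = adjoin k A` is the image of `k[ℚ]` in `K`.** [folklore] -/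
theorem adjoin_Amodel_eq_GK : Algebra.adjoin (RatFunc F) (Amodel F : Set (KField F)) = GK F := by
  refine le_antisymm (Algebra.adjoin_le fun x hx => ?_) ?_
  · obtain ⟨f, hf⟩ := exists_algebraMap_eq_of_isIntegral F (mem_nrIn_iff.mp hx)
    exact ⟨f, hf⟩
  · rintro _ ⟨f, rfl⟩
    change algebraMap (GAlg F) (KField F) f ∈ _
    induction f using AddMonoidAlgebra.induction_linear with
    | zero => rw [map_zero]; exact Subalgebra.zero_mem _
    | add f g hf hg => rw [map_add]; exact Subalgebra.add_mem _ hf hg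
    | single q a =>
      rw [algebraMap_single, ← Algebra.smul_def]
      exact Subalgebra.smul_mem _ (Algebra.subset_adjoin (tq_mem_Amodel F q)) a

/-- `S = k[A] = adjoin k A`, the coordinate ring of the generic fibre `X_η`. [folklore] -/
abbrev Sfib : Subalgebra (RatFunc F) (KField F) :=
  Algebra.adjoin (RatFunc F) (Amodel F : Set (KField F))

/-- **`k[ℚ] ≅ k[A]`.** [folklore] -/
def eS : GAlg F ≃ₐ[RatFunc F] Sfib F :=
  (eGK F).trans (Subalgebra.equivOfEq _ _ (adjoin_Amodel_eq_GK F).symm)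

/-- `eS` followed by the inclusion is the structure map `G → K`. [folklore] -/
theorem coe_eS (f : GAlg F) : (eS F f : KField F) = algebraMap (GAlg F) (KField F) f := rfl

/-- `eS⁻¹` of the image of `f` is `f`. [folklore] -/
theorem eS_symm_mk (f : GAlg F) (h : algebraMap (GAlg F) (KField F) f ∈ Sfib F) :
    (eS F).symm ⟨algebraMap (GAlg F) (KField F) f, h⟩ = f := by
  rw [AlgEquiv.symm_apply_eq]
  exact Subtype.ext rfl

/-! ### The `k`-point `x`: the augmentation -/

/-- The **augmentation** `φ : k[A] ≅ k[ℚ] → k`, `t^q ↦ 1`; its kernel is the closed point `x` of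
the generic fibre, with residue field `m = k`. [folklore] -/
def phi : Sfib F →ₐ[RatFunc F] RatFunc F :=
  (lift (RatFunc F) (RatFunc F) ℚ 1).comp (eS F).symm.toAlgHom

/-- `φ(t^q) = 1`. [folklore] -/
theorem phi_tq (q : ℚ) (h : tq F q ∈ Sfib F) : phi F ⟨tq F q, h⟩ = 1 := by
  change lift (RatFunc F) (RatFunc F) ℚ 1 ((eS F).symm ⟨algebraMap _ _ (single q 1), h⟩) = 1
  rw [eS_symm_mk, lift_single, one_smul, MonoidHom.one_apply]

/-- `φ` is surjective. [folklore] -/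
theorem phi_surjective : Function.Surjective (phi F) := fun c =>
  ⟨algebraMap (RatFunc F) (Sfib F) c, AlgHom.commutes _ c⟩

/-- The image in `K` of `φ⁻¹(k°) ⊆ k[A]`. [folklore] -/
def phiInt : Subring (KField F) :=
  ((Ok F).toSubring.comap (phi F : Sfib F →+* RatFunc F)).map (Sfib F).val.toRingHom

/-- Membership in `phiInt`. [folklore] -/
theorem mem_phiInt_iff {x : KField F} (hx : x ∈ Sfib F) :
    x ∈ phiInt F ↔ phi F ⟨x, hx⟩ ∈ Ok F := by
  constructor
  · rintro ⟨y, hy, hyx⟩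
    have : y = ⟨x, hx⟩ := Subtype.ext hyx
    rw [← this]
    exact hy
  · intro h
    exact ⟨⟨x, hx⟩, h, rfl⟩

/-- `phiInt ⊆ k[A]`. [folklore] -/
theorem phiInt_le_Sfib : phiInt F ≤ (Sfib F).toSubring := by
  rintro _ ⟨y, -, rfl⟩
  exact y.2

/-- `φ(k°[t, t⁻¹]) ⊆ k°`: `φ` is the identity on `k°` and `φ(t^{±1}) = 1`. [folklore] -/
theorem C0_le_phiInt : C0 F ≤ phiInt F := by
  rw [Subring.closure_le]
  rintro x (⟨c, hc, rfl⟩ | hx)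
  · rw [SetLike.mem_coe, mem_phiInt_iff F (Subalgebra.algebraMap_mem _ c)]
    have : (⟨algebraMap (RatFunc F) (KField F) c, Subalgebra.algebraMap_mem _ c⟩ : Sfib F) =
        algebraMap (RatFunc F) (Sfib F) c := rfl
    rw [this, AlgHom.commutes]
    exact hc
  · have : x = tq F 1 ∨ x = tq F (-1) := by
      classical simpa [sgen] using hx
    rcases this with rfl | rfl
    · rw [SetLike.mem_coe, mem_phiInt_iff F (Algebra.subset_adjoin (tq_mem_Amodel F 1)), phi_tq]
      exact one_mem _
    · rw [SetLike.mem_coe, mem_phiInt_iff F (Algebra.subset_adjoin (tq_mem_Amodel F (-1))), phi_tq]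
      exact one_mem _

/-- `C₀ ⊆ k[A]`. [folklore] -/
theorem C0_le_Sfib : C0 F ≤ (Sfib F).toSubring := (C0_le_phiInt F).trans (phiInt_le_Sfib F)

/-- `φ` takes elements of `k[A]` integral over `C₀` into `k°` (`k°` is integrally closed).
[folklore] -/
theorem phi_mem_Ok {x : KField F} (hxS : x ∈ Sfib F) (hx : IsIntegral (C0 F) x) :
    phi F ⟨x, hxS⟩ ∈ Ok F := by
  let ρS : C0 F →+* Sfib F := (C0 F).subtype.codRestrict (Sfib F) fun c => C0_le_Sfib F c.2
  let ψ : C0 F →+* Ok F := ((phi F : Sfib F →+* RatFunc F).comp ρS).codRestrict (Ok F) fun c =>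
    (mem_phiInt_iff F (C0_le_Sfib F c.2)).mp (C0_le_phiInt F c.2)
  obtain ⟨p, hp, hpx⟩ := hx
  have h1 : Polynomial.eval₂ ρS ⟨x, hxS⟩ p = 0 := by
    apply Subtype.val_injective
    change (Sfib F).val.toRingHom (Polynomial.eval₂ ρS ⟨x, hxS⟩ p) = 0
    rw [Polynomial.hom_eval₂]
    exact hpx
  have h2 : Polynomial.eval₂ (algebraMap (Ok F) (RatFunc F)) (phi F ⟨x, hxS⟩) (p.map ψ) = 0 := by
    rw [Polynomial.eval₂_map]
    have : (algebraMap (Ok F) (RatFunc F)).comp ψ = (phi F : Sfib F →+* RatFunc F).comp ρS :=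
      RingHom.ext fun _ => rfl
    rw [this]
    have h3 := Polynomial.hom_eval₂ p ρS (phi F : Sfib F →+* RatFunc F) ⟨x, hxS⟩
    rw [h1, map_zero] at h3
    exact h3.symm
  have hint : IsIntegral (Ok F) (phi F ⟨x, hxS⟩) := ⟨p.map ψ, hp.map ψ, h2⟩
  obtain ⟨y, hy⟩ := (IsIntegrallyClosed.isIntegral_iff (R := Ok F) (K := RatFunc F)).mp hint
  rw [← hy]
  exact y.2

/-- **`φ(A) ⊆ k°`**: the closed point `x` extends to a morphism `i : Spec k° → X = Spec A`.
[folklore] -/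
theorem phi_mem_Ok_of_mem_Amodel (a : Amodel F) :
    phi F ⟨a, Algebra.subset_adjoin a.2⟩ ∈ Ok F :=
  phi_mem_Ok F _ (mem_nrIn_iff.mp a.2)

/-! ### No common smooth cover -/

/-- The structure map `k° → A′` of a refinement `A′ ⊇ A` containing `k°` (as in the conclusion of
`Temkin2013_Lemma332`). [folklore] -/
abbrev baseMap (A' : Subring (KField F))
    (hkA' : ∀ c : Ok F, algebraMap (RatFunc F) (KField F) c ∈ A') : Ok F →+* A' :=
  ((algebraMap (RatFunc F) (KField F)).comp (Ok F).subtype).codRestrict A' hkA'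

set_option maxHeartbeats 400000 in
/-- **Key step (no common smooth cover).** For a refinement `A ≤ A′ ≤ k[A]` containing `k°`,
there is no nonzero ring `D` smooth over `A′` and over `k°` with structure maps agreeing on `k°`:
otherwise `E = D[1/π]` (`π` a uniformizer of `k°`) would be a nonzero finitely presented
`k[ℚ]`-algebra of finite type over `k` (see the module docstring), contradicting
`RatGroupAlgebra.subsingleton_of_finitePresentation_of_finiteType`. (Raised heartbeat limit: many
algebra structures on `E`.) [folklore] -/
theorem no_smooth_cover (A' : Subring (KField F)) (hA'S : ∀ a ∈ A', a ∈ Sfib F)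
    (hAA' : Amodel F ≤ A') (hkA' : ∀ c : Ok F, algebraMap (RatFunc F) (KField F) c ∈ A')
    (D : Type u) [CommRing D] [Algebra A' D] [Algebra (Ok F) D]
    (hcomp : ∀ c : Ok F, algebraMap A' D (baseMap F A' hkA' c) = algebraMap (Ok F) D c)
    [Algebra.Smooth A' D] [Algebra.Smooth (Ok F) D] [Nontrivial D] : False := by
  classical
  haveI := isDiscreteValuationRing_Ok F
  set f₁ := baseMap F A' hkA' with hf₁
  obtain ⟨π, hπ⟩ := IsDiscreteValuationRing.exists_irreducible (Ok F)
  have hπ0 : π ≠ 0 := hπ.ne_zero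
  set πD : D := algebraMap (Ok F) D π with hπD
  -- `π` is `D`-regular (flatness), so `E = D[1/π] ≠ 0`
  haveI : Module.Flat (Ok F) D := Algebra.Smooth.flat _ _
  have hpow : ∀ n : ℕ, πD ^ n ≠ 0 := by
    intro n hn
    have hreg : IsSMulRegular D (π ^ n) :=
      (Module.Flat.isSMulRegular_of_nonZeroDivisors (mem_nonZeroDivisors_of_ne_zero hπ0)).pow n
    have : (π ^ n) • (1 : D) = (π ^ n) • (0 : D) := by
      rw [smul_zero, Algebra.smul_def, mul_one, map_pow, ← hπD, hn]
    exact one_ne_zero (hreg this)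
  let E := Localization.Away πD
  haveI : Nontrivial E := by
    rw [← not_subsingleton_iff_nontrivial,
      IsLocalization.subsingleton_iff (M := Submonoid.powers πD) (S := E)]
    rintro ⟨n, hn⟩
    exact hpow n hn
  -- nonzero constants of `k°` become units in `E` (height one: `c = u πⁿ`)
  have hπE : IsUnit (algebraMap (Ok F) E π) := by
    rw [IsScalarTower.algebraMap_apply (Ok F) D E]
    exact IsLocalization.Away.algebraMap_isUnit πD
  have hunitE : ∀ c : Ok F, c ≠ 0 → IsUnit (algebraMap (Ok F) E c) := by
    intro c hc
    obtain ⟨n, u, rfl⟩ := IsDiscreteValuationRing.eq_unit_mul_pow_irreducible hc hπ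
    rw [map_mul, map_pow]
    exact ((Units.isUnit u).map _).mul (hπE.pow n)
  -- `E` is a `k`-algebra of finite type
  letI algkE : Algebra (RatFunc F) E :=
    (IsLocalization.lift (M := nonZeroDivisors (Ok F)) (S := RatFunc F) (g := algebraMap (Ok F) E)
      fun y => hunitE y (nonZeroDivisors.ne_zero y.2)).toAlgebra
  haveI : IsScalarTower (Ok F) (RatFunc F) E :=
    IsScalarTower.of_algebraMap_eq fun c => (IsLocalization.lift_eq _ c).symm
  haveI : Algebra.FinitePresentation (Ok F) D := Algebra.Smooth.finitePresentation
  haveI : Algebra.FinitePresentation D E := IsLocalization.Away.finitePresentation πD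
  haveI : Algebra.FinitePresentation (Ok F) E := .trans (Ok F) D E
  haveI : Algebra.FiniteType (RatFunc F) E :=
    Algebra.FiniteType.of_restrictScalars_finiteType (Ok F) (RatFunc F) E
  -- `S = k[A] = A′[1/π]`
  let σ : A' →+* Sfib F := A'.subtype.codRestrict (Sfib F) fun a => hA'S a a.2
  letI : Algebra A' (Sfib F) := σ.toAlgebra
  have hf₁π : algebraMap A' (Sfib F) (f₁ π) = algebraMap (RatFunc F) (Sfib F) π :=
    Subtype.ext rfl
  have hπk : (π : RatFunc F) ≠ 0 := fun h => hπ0 (by exact_mod_cast h)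
  haveI : IsLocalization.Away (f₁ π) (Sfib F) := by
    refine IsLocalization.Away.mk _ ?_ ?_ ?_
    · rw [hf₁π]
      exact (IsUnit.mk0 _ hπk).map _
    · intro s
      obtain ⟨c, hc, hcf⟩ := exists_smul_mem_Amodel F ((eS F).symm s)
      obtain ⟨n, u, rfl⟩ := IsDiscreteValuationRing.eq_unit_mul_pow_irreducible hc hπ
      refine ⟨n, f₁ ↑(u⁻¹) * ⟨_, hAA' hcf⟩, Subtype.ext ?_⟩
      change (s : KField F) * (algebraMap (RatFunc F) (KField F) π) ^ n =
        algebraMap (RatFunc F) (KField F) ↑(↑(u⁻¹) : Ok F) *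
          (algebraMap (RatFunc F) (KField F) ↑(↑u * π ^ n) *
            algebraMap (GAlg F) (KField F) ((eS F).symm s))
      have hs : algebraMap (GAlg F) (KField F) ((eS F).symm s) = s := by
        rw [← coe_eS, AlgEquiv.apply_symm_apply]
      rw [hs]
      simp only [MulMemClass.coe_mul, SubmonoidClass.coe_pow, map_mul, map_pow]
      rw [← mul_assoc, ← mul_assoc, ← map_mul, ← Subring.coe_mul, ← Units.val_mul, inv_mul_cancel,
        Units.val_one, Subring.coe_one, map_one, one_mul, mul_comm]
    · intro a b hab
      have hab' : ((algebraMap A' (Sfib F) a : Sfib F) : KField F) = algebraMap A' (Sfib F) b :=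
        congrArg Subtype.val hab
      exact ⟨0, by rw [pow_zero, one_mul, one_mul]; exact Subtype.ext hab'⟩
  -- `E` is an `S`-algebra, finitely presented
  have hπA'E : IsUnit (algebraMap A' E (f₁ π)) := by
    rw [IsScalarTower.algebraMap_apply A' D E, hcomp, ← IsScalarTower.algebraMap_apply]
    exact hπE
  letI algSE : Algebra (Sfib F) E := (IsLocalization.Away.lift (f₁ π) hπA'E).toAlgebra
  haveI : IsScalarTower A' (Sfib F) E :=
    IsScalarTower.of_algebraMap_eq fun a => (IsLocalization.Away.lift_eq (f₁ π) hπA'E a).symm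
  haveI : Algebra.FinitePresentation A' (Sfib F) := IsLocalization.Away.finitePresentation (f₁ π)
  haveI : Algebra.FinitePresentation A' D := Algebra.Smooth.finitePresentation
  haveI : Algebra.FinitePresentation A' E := .trans A' D E
  haveI : Algebra.FinitePresentation (Sfib F) E :=
    .of_restrict_scalars_finitePresentation A' (Sfib F) E
  -- `E` is a finitely presented `k[ℚ]`-algebra
  letI algGE : Algebra (GAlg F) E :=
    ((algebraMap (Sfib F) E).comp (eS F).toAlgHom.toRingHom).toAlgebra
  letI algSG : Algebra (Sfib F) (GAlg F) := (eS F).symm.toAlgHom.toRingHom.toAlgebra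
  haveI : IsScalarTower (Sfib F) (GAlg F) E := IsScalarTower.of_algebraMap_eq fun s => by
    change algebraMap (Sfib F) E s = algebraMap (Sfib F) E ((eS F) ((eS F).symm s))
    rw [AlgEquiv.apply_symm_apply]
  haveI : Algebra.FiniteType (Sfib F) (GAlg F) :=
    Algebra.FiniteType.of_surjective (Algebra.ofId (Sfib F) (GAlg F)) (eS F).symm.surjective
  haveI : Algebra.FinitePresentation (GAlg F) E :=
    .of_restrict_scalars_finitePresentation (Sfib F) (GAlg F) E
  -- compatibility of the two `k`-structures (they agree on `k°`, and `k = Frac k°`)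
  haveI : IsScalarTower (RatFunc F) (GAlg F) E := by
    refine IsScalarTower.of_algebraMap_eq fun c => ?_
    change algebraMap (RatFunc F) E c = algebraMap (Sfib F) E (eS F (algebraMap (RatFunc F) (GAlg F) c))
    rw [AlgEquiv.commutes]
    revert c
    refine fun c => RingHom.congr_fun (IsLocalization.ringHom_ext (nonZeroDivisors (Ok F))
      (S := RatFunc F) (j := algebraMap (RatFunc F) E)
      (k := (algebraMap (Sfib F) E).comp (algebraMap (RatFunc F) (Sfib F))) ?_) c
    ext c
    rw [RingHom.comp_apply, RingHom.comp_apply, RingHom.comp_apply,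
      ← IsScalarTower.algebraMap_apply (Ok F) (RatFunc F) E]
    have : algebraMap (RatFunc F) (Sfib F) (algebraMap (Ok F) (RatFunc F) c) =
        algebraMap A' (Sfib F) (f₁ c) := Subtype.ext rfl
    rw [this, ← IsScalarTower.algebraMap_apply A' (Sfib F) E,
      IsScalarTower.algebraMap_apply A' D E, hcomp, ← IsScalarTower.algebraMap_apply]
  haveI := subsingleton_of_finitePresentation_of_finiteType (k := RatFunc F) E
  exact false_of_nontrivial_of_subsingleton E

/-! ### The refutation -/

-- `Temkin2013_Lemma332` is `@[deprecated]` (mis-rendered, refuted; 2026-08-15) and its refutation must name it;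
-- REMOVE-WHEN the deprecated def is deleted from `InseparableLocalUniformizationLemmas.lean`.
set_option linter.deprecated false in
/-- **The counterexample assembled**: `Temkin2013_Lemma332` fails for `k = F(X)` (`F` of
characteristic zero) with the `X`-adic valuation, `K = Frac k[ℚ]`, `A = Nr_K(k°[t, t⁻¹])`,
`m = k`, `x` the augmentation point and `m° = k°`: all hypotheses hold (`x` is `k`-smooth as
`k[A] ≅ k[ℚ]` is formally smooth over `k`), and a refinement `A′` with a common smooth cover `D` of
its special point and the closed point of `Spec k°` is excluded by `no_smooth_cover`. [folklore] -/
theorem not_lemma332_aux [CharZero F] (h : Temkin2013_Lemma332.{u}) : False := by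
  haveI hxp : (RingHom.ker (phi F : Sfib F →+* RatFunc F)).IsPrime := RingHom.ker_isPrime _
  have hsm : Algebra.IsSmoothAt (RatFunc F) (RingHom.ker (phi F : Sfib F →+* RatFunc F)) := by
    haveI := formallySmooth_rat (RatFunc F)
    haveI : Algebra.FormallySmooth (RatFunc F) (Sfib F) := .of_equiv (eS F)
    change Algebra.FormallySmooth (RatFunc F) (Localization.AtPrime _)
    infer_instance
  have hOm : (Ok F).comap (algebraMap (RatFunc F) (RatFunc F)) = Ok F := by
    ext x
    rw [ValuationSubring.mem_comap, Algebra.algebraMap_self, RingHom.id_apply]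
  obtain ⟨A', hAA', -, hA'S, hi', hkA', hkm, hse⟩ :=
    h (RatFunc F) (KField F) (Ok F) (ringChar_residueField_Ok F) (ringKrullDim_Ok F) (Amodel F)
      (isAffineNormalizedModel_Amodel F) (RatFunc F) (phi F) (phi_surjective F)
      (RingHom.ker (phi F : Sfib F →+* RatFunc F)) rfl hsm inferInstance (Ok F) hOm
      (phi_mem_Ok_of_mem_Amodel F)
  obtain ⟨D, _, _, _, hcomp, hsA, hsO, r, hr, -, -⟩ := hse
  haveI : Nontrivial D :=
    ⟨⟨0, 1, fun h01 => hr.ne_top ((Ideal.eq_top_iff_one r).mpr (h01 ▸ r.zero_mem))⟩⟩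
  haveI := hsA
  haveI := hsO
  refine no_smooth_cover F A' hA'S hAA' hkA' D (fun c => ?_)
  have := RingHom.congr_fun hcomp c
  simp only [RingHom.comp_apply] at this
  convert this using 2
  exact Subtype.ext (by simp)

end Lemma332Counterexample

-- `Temkin2013_Lemma332` is `@[deprecated]` (mis-rendered, refuted; 2026-08-15) and its refutation must name it;
-- REMOVE-WHEN the deprecated def is deleted from `InseparableLocalUniformizationLemmas.lean`.
set_option linter.deprecated false in
/-- **`Temkin2013_Lemma332` — the tree's rendering of Temkin 2013, Lemma 3.3.2, which omits the
printed hypothesis "`X → S` of normalized finite presentation" — is false**, in every universe: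
`Lemma332Counterexample.not_lemma332_aux` with `F = ULift ℚ` (see the module docstring for the
counterexample). The printed lemma concerns schemes of normalized finite presentation; its
corrected rendering is `Temkin2013_Lemma332_nft`
(`InseparableLocalUniformizationDecompletion.lean`), which this theorem does not touch. Do NOT
take `(h : Temkin2013_Lemma332)` as a hypothesis. [folklore] -/
theorem not_temkin2013_Lemma332 : ¬ Temkin2013_Lemma332.{u} := fun h =>
  haveI : CharZero (ULift.{u} ℚ) :=
    RingHom.charZero (ULift.ringEquiv : ULift.{u} ℚ ≃+* ℚ).toRingHom
  Lemma332Counterexample.not_lemma332_aux (ULift.{u} ℚ) h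

end Literature.AlgebraicGeometry.Resolution
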